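import Summits.ResolutionOfSingularities.ResolutionOfSingularities.Theorems.HilbertSamuelEliminationSigmaMaxModificationsCorridor3WLadderIsoTailsTowerBaseChangePoints
import Summits.ResolutionOfSingularities.ResolutionOfSingularities.Theorems.HilbertSamuelEliminationSigmaMaxModificationsCorridor3WLadderIsoTailsBaseChangeCentreStalk
import Literature.AlgebraicGeometry.Resolution.StalkIdealLemmas
import HarnessLib

/-!
# [OURS · L1 W4.2] K2-sep ROUTE A, brick (δ4, second part): **`𝔪_x · 𝒪_{X′,x′} = 𝔪_{x′}` along a flat geometrically reduced morphism at a
# point of a finite closed fibre** — in particular along `pr₁ : X ×_k K → X` and along the comparison maps `ι_n : S_n → X_n` of the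
# base-changed tower, over CLOSED points (ideal-sheaf proof: `𝔪_x = 𝓘({x})_x`, `(𝓘({x}) · 𝒪_{X′})_{x′} = 𝔪_x · 𝒪_{x′}`
# (`stalkIdeal_comap_eq_map_stalkMap`), `𝓘({x}) · 𝒪_{X′} = 𝓘(pr⁻¹{x})` (flat + geometrically reduced), and `𝓘(finite set)_{x′} = 𝔪_{x′}`)
# (crux `SigmaMaxModifications` stmt-ResolutionOfSingularities-18506 / conjunct stmt-…-19249; line `w_ladder_rows` v8.5, registered stub
# `stub_isoSepRecurrent`; res-L1-w42-plan-1 WORD 2026-08-27T16:25:47Z; design `L/res-L1-w42-stub-2/k2sep/K2SEP-DESIGN.md` §8 (δ4))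

Prover res-L1-w42-stub-2 (gen 5). Helper file `--supports stmt-ResolutionOfSingularities-19249 --as helper`; no definitions, no named fact. OURS
(cell res-hironaka, slot W4.2); NOT statements of [Hironaka2017] nor of [CossartJannsenSaito2020]. AI-written; AI review is weaker than expert
review. This is the stalk-level input of the SATELLITE-STEP transfer (`IsSatelliteStep` compares `𝔪_{x_n}·𝒪_{x_{n+2}}` with `𝔪_{x_{n+1}}·𝒪_{x_{n+2}}`)
and of `hD` for the base-changed tower.

* **`map_maximalIdeal_stalkMap_eq_of_flat_of_geometricallyReduced`** — `f : X′ → X` flat, geometrically reduced, `X` locally noetherian, `x` closed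
  with `f⁻¹{x}` finite and consisting of closed points, `f x′ = x` ⟹ `𝔪_x · 𝒪_{X′,x′} = 𝔪_{x′}`.
* **`BlowupTower.map_maximalIdeal_stalkMap_bcι_eq`** — the case `ι_n : S_n → X_n` of the ground-field base change of a tower, over a closed point.

[OURS · L1 W4.2; AI-written] [cite: CossartJannsenSaito2020, Lemma 2.27 (1), p. 107] [cite: GrothendieckDieudonne1965, Prop. (4.6.1)]
-/

set_option linter.dupNamespace false

noncomputable section

open CategoryTheory CategoryTheory.Limits AlgebraicGeometry TopologicalSpace IsLocalRing
open Literature.AlgebraicGeometry.Resolution Literature.AlgebraicGeometry.CossartJannsenSaito2020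
open Scheme.IdealSheafData

namespace Summit.ResolutionOfSingularities.ResolutionOfSingularities.Theorems.SigmaMaxModificationsCorridor3.IsoTailsHS

universe u

/-- **`𝔪_x · 𝒪_{X′,x′} = 𝔪_{x′}`** for `f : X′ → X` flat and geometrically reduced (`X` locally noetherian), `x = f x′` closed with finite fibre of
closed points: `𝔪_x = 𝓘({x})_x`, its extension is the stalk of `𝓘({x})·𝒪_{X′} = 𝓘(f⁻¹{x})` (reduced pull-back of a reduced centre), and the stalk
of the vanishing ideal of the finite closed set `f⁻¹{x}` at `x′` is `𝔪_{x′}`. [cite: CossartJannsenSaito2020, Lemma 2.27 (1)] -/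
theorem map_maximalIdeal_stalkMap_eq_of_flat_of_geometricallyReduced {X' X : Scheme.{u}} (f : X' ⟶ X) [Flat f] [GeometricallyReduced f]
    [IsLocallyNoetherian X] {x : X} (hx : IsClosed ({x} : Set X)) (hfin : (f.base ⁻¹' {x}).Finite)
    (hcl : ∀ y ∈ f.base ⁻¹' {x}, IsClosed ({y} : Set X')) {x' : X'} (hx' : f.base x' = x) :
    (maximalIdeal (X.presheaf.stalk (f.base x'))).map (f.stalkMap x').hom = maximalIdeal (X'.presheaf.stalk x') := by
  subst hx'
  rw [← stalkIdeal_vanishingIdeal_singleton hx, ← stalkIdeal_comap_eq_map_stalkMap f,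
    comap_vanishingIdeal_eq_of_flat_of_geometricallyReduced f ⟨{f.base x'}, hx⟩]
  exact stalkIdeal_vanishingIdeal_eq_maximalIdeal_of_finite _ hfin hcl (Set.mem_preimage.mpr rfl)

namespace BlowupTower

variable (T : BlowupTower.{u}) {k K : Type u} [Field k] [Field K] [Algebra k K] [Algebra.IsSeparable k K]
  (f : T.X 0 ⟶ Spec (CommRingCat.of k)) [LocallyOfFiniteType f]

/-- **`𝔪_{x_n} · 𝒪_{S_n, s} = 𝔪_s`** along the comparison map `ι_n : S_n → X_n` of the ground-field base change of a tower (`K/k` separable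
algebraic), at a point `s` over a CLOSED point `x_n` (flat + geometrically reduced `ι_n`, finite closed fibre). [cite: CossartJannsenSaito2020, p. 107] -/
theorem map_maximalIdeal_stalkMap_bcι_eq (n : ℕ) {s : ↥(T.bcX (pullback.fst f (Spec.map (CommRingCat.ofHom (algebraMap k K)))) n)}
    (hx : IsClosed ({(T.bcι (pullback.fst f (Spec.map (CommRingCat.ofHom (algebraMap k K)))) n).base s} : Set (T.X n))) :
    (maximalIdeal ((T.X n).presheaf.stalk ((T.bcι (pullback.fst f (Spec.map (CommRingCat.ofHom (algebraMap k K)))) n).base s))).map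
        ((T.bcι (pullback.fst f (Spec.map (CommRingCat.ofHom (algebraMap k K)))) n).stalkMap s).hom =
      maximalIdeal ((T.bcX (pullback.fst f (Spec.map (CommRingCat.ofHom (algebraMap k K)))) n).presheaf.stalk s) := by
  haveI : IsLocallyNoetherian (T.X n) := T.ln n
  haveI := geometricallyReduced_SpecMap_algebraMap_of_isSeparable k K
  haveI : Flat (Spec.map (CommRingCat.ofHom (algebraMap k K))) := by
    rw [HasRingHomProperty.Spec_iff (P := @Flat), CommRingCat.hom_ofHom, RingHom.flat_algebraMap_iff]
    infer_instance
  haveI : Flat (pullback.fst f (Spec.map (CommRingCat.ofHom (algebraMap k K)))) := inferInstance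
  haveI : GeometricallyReduced (pullback.fst f (Spec.map (CommRingCat.ofHom (algebraMap k K)))) := inferInstance
  haveI := T.flat_bcι (pullback.fst f (Spec.map (CommRingCat.ofHom (algebraMap k K)))) n
  haveI := geometricallyReduced_bcι T (pullback.fst f (Spec.map (CommRingCat.ofHom (algebraMap k K)))) n
  exact map_maximalIdeal_stalkMap_eq_of_flat_of_geometricallyReduced _ hx (finite_preimage_bcι n hx)
    (fun y hy => isClosed_singleton_bcX n hx hy) rfl

end BlowupTower

end Summit.ResolutionOfSingularities.ResolutionOfSingularities.Theorems.SigmaMaxModificationsCorridor3.IsoTailsHS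

end
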